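import Summits.RiemannHypothesis.RiemannHypothesis.Theorems.SemilocalDeletionToeplitzFloor
import HarnessLib

/-!
# The all-window CEILING of prime deletion: `λ_min(S∖{p}; c; P) ≤ λ_min(S; c; P) + 2·log p/(√p − 1)` on every window

`SemilocalDeletionToeplitzFloor.lean` wrote the effect of deleting a prime `p ∈ S` (with `m` visible powers on `[−c, c]`) as the
fibre form of the zero-diagonal Toeplitz matrix `A_m(p) = log p·(K_{m+1}(ρ) − I)`, `K_n(ρ) = [ρ^{|i−j|}]`, `ρ = 1/√p`, and turned any
certificate `A_m(p) ⪰ −μ` into the FLOOR `λ_min(S∖p) ≥ λ_min(S) − μ`; `SemilocalDeletionToeplitzFloorUniform.lean` proved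
`K_n(ρ) ⪰ (1−ρ)/(1+ρ)` for all `n`, whence the all-window floor `2·log p/(√p + 1)`.  This file is the OTHER SIDE:

* §1 `re_weilSemilocalQuadratic_erase_le_of_cert` / `semilocalGroundEnergy_erase_le_of_cert` — the mirrored lift: a certificate
  `A_m(p) ⪯ μ` gives the CEILING `Re Q_{S∖p}(g) ≤ Re Q_S(g) + μ‖g‖₂²`, `λ_min(S∖p; c; P) ≤ λ_min(S; c; P) + μ` (adding the prime back
  lowers no bottom by more than `μ`);
* §2 `kms_causal_upper`, `kms_offdiag_real_upper`, `cert_uniform_upper` — `K_n(ρ) ⪯ (1+ρ)/(1−ρ)` for all `n` (the KMS symbol's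
  MAXIMUM, at `θ = 0`), by the same causal filter as the floor: `xᵀKx = (1−ρ²)Σu_i² + ρ²u_n²` together with the lower comparison
  `Σx_i² ≥ (1−ρ)²Σu_i² + ρ(1−ρ)u_n²`; hence `A_m(p) ⪯ 2ρ/(1−ρ)·log p = 2·log p/(√p − 1)`;
* §3 the ALL-WINDOW CEILING `λ_min(S∖p; c; P) ≤ λ_min(S; c; P) + 2·log p/(√p − 1)` (every `c`, `P`, finite `S ∋ p`) and its set
  version `λ_min(S∖T) ≤ λ_min(S) + Σ_{p∈T} 2·log p/(√p − 1)`.  With the floor of `SemilocalDeletionToeplitzFloorUniform.lean` this gives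
  the two-sided MODULUS and the Lipschitz law in the prime set (`SemilocalDeletionAllWindowModulus.lean`).

Values of `2·log p/(√p − 1)`: `p = 2`: `3.3468`, `3`: `3.0015`, `5`: `2.6041`, `7`: `2.3648`, `11`: `2.0702` (decreasing to `0` like
`2·log p/√p`).  In the lineage-E census deleting a prime always LOWERED the bottom (the floor side, sharp); the ceiling side is the
a-priori room for the opposite sign (a bottom state aligned with the symmetric pairs of `SemilocalDeletionDipole.lean` §4, which a
deletion RAISES).  Nothing here bears on RH; these are statements about truncated Weil forms.
-/

set_option linter.dupNamespace false

noncomputable section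

open Complex Filter Set MeasureTheory
open scoped Real Topology ComplexConjugate

namespace Summit.RiemannHypothesis.RiemannHypothesis.Theorems.SemilocalDeletionToeplitzCeiling

open Literature.NumberTheory.LFunctions
open Summit.RiemannHypothesis.RiemannHypothesis.Theorems.SemilocalDeletionToeplitzFloor
open Summit.RiemannHypothesis.RiemannHypothesis.Theorems.SemilocalDeletionCliff
open Summit.RiemannHypothesis.RiemannHypothesis.Theorems.HandoffSemilocalEnergy

variable {g : ℝ → ℂ}

/-! ## §1  The mirrored lift: a certificate `A_m(p) ⪯ μ` gives a CEILING -/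

/-- **Toeplitz ceiling (certificate form).** If for every `G : ℤ → ℂ` supported in `{0,…,m}`
`0 ≤ μ Σ_i |G_i|² − Σ_{d=1}^{m} (L/√(p^d)) Σ_i Re(G_i Ḡ_{i−d} + G_i Ḡ_{i+d})` (i.e. `A_m(p) ⪯ μ·I`), then on every window with `m`
visible powers `Re Q_{S∖{p}}(g) ≤ Re Q_S(g) + μ‖g‖₂²`.  (Proof = that of `re_weilSemilocalQuadratic_erase_ge_of_cert`, signs mirrored.) -/
theorem re_weilSemilocalQuadratic_erase_le_of_cert (hg : IsWeilTest g) {S : Finset ℕ} {p : ℕ} (hp : p.Prime) (hpS : p ∈ S)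
    {c : ℝ} (hsupp : tsupport g ⊆ Icc (-c) c) {m : ℕ} (hm : 2 * c < (m + 1) * Real.log p) {μ : ℝ}
    (hcert : ∀ G : ℤ → ℂ, (∀ n : ℤ, n < 0 → G n = 0) → (∀ n : ℤ, (m : ℤ) < n → G n = 0) →
      0 ≤ μ * ∑ i ∈ Finset.range (m + 1), ‖G i‖ ^ 2 -
        ∑ e ∈ Finset.range m, Real.log p / Real.sqrt ((p : ℝ) ^ (e + 1)) *
          ∑ i ∈ Finset.range (m + 1), (G i * conj (G ((i : ℤ) - (e + 1))) + G i * conj (G ((i : ℤ) + (e + 1)))).re) :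
    (weilSemilocalQuadratic (S.erase p) g).re ≤ (weilSemilocalQuadratic S g).re + μ * ∫ u : ℝ, ‖g u‖ ^ 2 := by
  set L := Real.log p with hLdef
  have hL : 0 < L := Real.log_pos (by exact_mod_cast hp.one_lt)
  set k := weilConv g (weilReflect g) with hkdef
  set w : ℕ → ℝ := fun d ↦ Real.log p / Real.sqrt ((p : ℝ) ^ d) with hwdef
  -- the perturbation and the deletion identity
  set P : ℂ := ∑ e ∈ Finset.range m, ((w (e + 1) : ℝ) : ℂ) * (k ((e + 1) * L) + k (-((e + 1) * L))) with hPdef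
  have hid : weilSemilocalQuadratic (S.erase p) g = weilSemilocalQuadratic S g + P := by
    have h := weilSemilocalQuadratic_sub_erase_pow hg hp hpS hsupp hm
    rw [← hkdef] at h
    linear_combination (-1 : ℂ) * h
  -- fibre integrands
  set I₀ := Ico (-c) (-c + L) with hI₀
  set T : ℕ → ℕ → ℝ → ℂ := fun e i v ↦
    g (v + i * L) * conj (g (v + i * L - (e + 1) * L)) + g (v + i * L) * conj (g (v + i * L + (e + 1) * L)) with hTdef
  have hTi : ∀ e i, Integrable (T e i) := fun e i ↦ by
    have h1 := integrable_shift_mul_conj_shift hg (i * L) (i * L - (e + 1) * L)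
    have h2 := integrable_shift_mul_conj_shift hg (i * L) (i * L + (e + 1) * L)
    have hT : T e i = (fun v ↦ g (v + i * L) * conj (g (v + (i * L - (e + 1) * L)))) +
        fun v ↦ g (v + i * L) * conj (g (v + (i * L + (e + 1) * L))) := by
      funext v
      simp only [hTdef, Pi.add_apply, add_sub_assoc, add_assoc]
    rw [hT]
    exact h1.add h2
  have hTre : ∀ e i, Integrable fun v ↦ (T e i v).re := fun e i ↦ (hTi e i).re
  have hNi : ∀ i : ℕ, Integrable fun v : ℝ ↦ ‖g (v + i * L)‖ ^ 2 := fun i ↦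
    hg.integrable_norm_sq.comp_add_right ((i : ℝ) * L)
  set Φ : ℝ → ℝ := fun v ↦ μ * ∑ i ∈ Finset.range (m + 1), ‖g (v + i * L)‖ ^ 2 -
    ∑ e ∈ Finset.range m, w (e + 1) * ∑ i ∈ Finset.range (m + 1), (T e i v).re with hΦdef
  -- (A) the fibre integral of Φ is μ‖g‖² − Re P
  have hnorm : ∫ u, ‖g u‖ ^ 2 = ∫ v in I₀, ∑ i ∈ Finset.range (m + 1), ‖g (v + i * L)‖ ^ 2 := by
    rw [integral_finsetSum (Finset.range (m + 1)) fun i _ ↦ (hNi i).integrableOn,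
      integral_norm_sq_eq_sum_cells hg hsupp hL hm]
  have hP : P = ∑ e ∈ Finset.range m, ((w (e + 1) : ℝ) : ℂ) * ∑ i ∈ Finset.range (m + 1), ∫ v in I₀, T e i v := by
    refine Finset.sum_congr rfl fun e _ ↦ ?_
    congr 1
    rw [hkdef, weilConv_weilReflect_eq_sum_cells hg hsupp hL hm, weilConv_weilReflect_eq_sum_cells hg hsupp hL hm,
      ← Finset.sum_add_distrib]
    refine Finset.sum_congr rfl fun i _ ↦ ?_
    rw [← integral_add]
    · refine setIntegral_congr_fun measurableSet_Ico fun v _ ↦ ?_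
      simp only [hTdef, sub_neg_eq_add]
    · have := integrable_shift_mul_conj_shift hg (i * L) (i * L - (e + 1) * L)
      exact (this.congr (Eventually.of_forall fun v ↦ by rw [add_sub_assoc])).integrableOn
    · have := integrable_shift_mul_conj_shift hg (i * L) (i * L + (e + 1) * L)
      exact (this.congr (Eventually.of_forall fun v ↦ by rw [sub_neg_eq_add, add_assoc])).integrableOn
  have hPre : P.re = ∫ v in I₀, ∑ e ∈ Finset.range m, w (e + 1) * ∑ i ∈ Finset.range (m + 1), (T e i v).re := by
    rw [hP, Complex.re_sum, integral_finsetSum _ fun e _ ↦ ?_]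
    · refine Finset.sum_congr rfl fun e _ ↦ ?_
      rw [Complex.re_ofReal_mul, Complex.re_sum, integral_const_mul,
        integral_finsetSum (Finset.range (m + 1)) fun i _ ↦ (hTre e i).integrableOn]
      congr 1
      refine Finset.sum_congr rfl fun i _ ↦ ?_
      have := integral_re ((hTi e i).integrableOn (s := I₀))
      simpa only [RCLike.re_to_complex] using this.symm
    · exact ((integrable_finsetSum (Finset.range (m + 1)) fun i _ ↦ hTre e i).const_mul (w (e + 1))).integrableOn
  have hA : ∫ v in I₀, Φ v = μ * (∫ u, ‖g u‖ ^ 2) - P.re := by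
    rw [hnorm, hPre, hΦdef, integral_sub, integral_const_mul]
    · exact ((integrable_finsetSum (Finset.range (m + 1)) fun i _ ↦ hNi i).const_mul μ).integrableOn
    · exact (integrable_finsetSum (Finset.range m) fun e _ ↦
        (integrable_finsetSum (Finset.range (m + 1)) fun i _ ↦ hTre e i).const_mul (w (e + 1))).integrableOn
  -- (B) Φ ≥ 0 on the base cell, from the certificate applied to the fibre vector
  have hB : ∀ v ∈ I₀, 0 ≤ Φ v := by
    intro v hv
    rw [hI₀, mem_Ico] at hv
    set G : ℤ → ℂ := fun n ↦ g (v + n * L) with hGdef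
    have hG1 : ∀ n : ℤ, n < 0 → G n = 0 := by
      intro n hn
      have hn' : (n : ℝ) ≤ -1 := by exact_mod_cast Int.le_sub_one_of_lt hn
      refine apply_eq_zero_of_not_mem hsupp fun h ↦ ?_
      rw [mem_Icc] at h
      nlinarith [h.1]
    have hG2 : ∀ n : ℤ, (m : ℤ) < n → G n = 0 := by
      intro n hn
      have hn' : (m : ℝ) + 1 ≤ n := by exact_mod_cast Int.add_one_le_of_lt hn
      refine apply_eq_zero_of_not_mem hsupp fun h ↦ ?_
      rw [mem_Icc] at h
      nlinarith [h.2]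
    have hc := hcert G hG1 hG2
    have hGi : ∀ i : ℕ, G i = g (v + i * L) := fun i ↦ by simp [hGdef]
    have hGm : ∀ i e : ℕ, G ((i : ℤ) - (e + 1)) = g (v + i * L - (e + 1) * L) := fun i e ↦ by
      simp only [hGdef]; push_cast; ring_nf
    have hGp : ∀ i e : ℕ, G ((i : ℤ) + (e + 1)) = g (v + i * L + (e + 1) * L) := fun i e ↦ by
      simp only [hGdef]; push_cast; ring_nf
    simp only [hGi, hGm, hGp] at hc
    simpa only [hΦdef, hTdef, hwdef] using hc
  have hpos : 0 ≤ ∫ v in I₀, Φ v := setIntegral_nonneg measurableSet_Ico hB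
  rw [hid, Complex.add_re]
  linarith [hA ▸ hpos]

variable {P : (ℝ → ℂ) → Prop}

/-- **Energy form of the ceiling:** under the certificate of `re_weilSemilocalQuadratic_erase_le_of_cert` with `μ ≥ 0`:
`λ_min(S∖{p}; c; P) ≤ λ_min(S; c; P) + μ`. -/
theorem semilocalGroundEnergy_erase_le_of_cert {S : Finset ℕ} {p : ℕ} (hp : p.Prime) (hpS : p ∈ S) {c : ℝ} {m : ℕ}
    (hm : 2 * c < (m + 1) * Real.log p) {μ : ℝ} (hμ : 0 ≤ μ)
    (hcert : ∀ G : ℤ → ℂ, (∀ n : ℤ, n < 0 → G n = 0) → (∀ n : ℤ, (m : ℤ) < n → G n = 0) →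
      0 ≤ μ * ∑ i ∈ Finset.range (m + 1), ‖G i‖ ^ 2 -
        ∑ e ∈ Finset.range m, Real.log p / Real.sqrt ((p : ℝ) ^ (e + 1)) *
          ∑ i ∈ Finset.range (m + 1), (G i * conj (G ((i : ℤ) - (e + 1))) + G i * conj (G ((i : ℤ) + (e + 1)))).re) :
    semilocalGroundEnergy (S.erase p) P c - μ ≤ semilocalGroundEnergy S P c := by
  rcases (semilocalSphereValues S P c).eq_empty_or_nonempty with he | hne
  · have he' : semilocalSphereValues (S.erase p) P c = ∅ := by
      rcases (semilocalSphereValues (S.erase p) P c).eq_empty_or_nonempty with h0 | h0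
      · exact h0
      · have := (semilocalSphereValues_nonempty_iff (S.erase p) P c).1 h0
        rw [← semilocalSphereValues_nonempty_iff S P c, he] at this
        exact absurd this Set.not_nonempty_empty
    rw [semilocalGroundEnergy, semilocalGroundEnergy, he, he', Real.sInf_empty]
    linarith
  · refine le_semilocalGroundEnergy hne fun g hg hs hPg hn ↦ ?_
    have h1 := re_weilSemilocalQuadratic_erase_le_of_cert hg hp hpS hs hm hcert
    have h2 := semilocalGroundEnergy_le_re (S := S.erase p) hg hs hPg hn
    rw [hn, mul_one] at h1
    linarith

/-! ## §2  `K_n(ρ) ⪯ (1+ρ)/(1−ρ)` by the causal filter -/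

/-- Causal-filter bookkeeping for the ceiling: with `v₀ = 0`, `v_{i+1} = ρ(v_i + x_i)` (`i < n`) and `u = x + v`:
`Σ x_i² + 2Σ x_i v_i = (1−ρ²)Σ u_i² + ρ² u_n²` and `Σ x_i² ≥ (1−ρ)²Σ u_i² + ρ(1−ρ) u_n²`. -/
theorem causal_filter_aux_upper {ρ : ℝ} (hρ : 0 ≤ ρ) (x v : ℕ → ℝ) (hv0 : v 0 = 0) :
    ∀ n : ℕ, (∀ i < n, v (i + 1) = ρ * (v i + x i)) →
      (∑ i ∈ Finset.range (n + 1), x i ^ 2 + 2 * ∑ i ∈ Finset.range (n + 1), x i * v i =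
          (1 - ρ ^ 2) * ∑ i ∈ Finset.range (n + 1), (x i + v i) ^ 2 + ρ ^ 2 * (x n + v n) ^ 2) ∧
        (1 - ρ) ^ 2 * ∑ i ∈ Finset.range (n + 1), (x i + v i) ^ 2 + ρ * (1 - ρ) * (x n + v n) ^ 2 ≤
          ∑ i ∈ Finset.range (n + 1), x i ^ 2 := by
  intro n
  induction n with
  | zero =>
    intro _
    simp only [zero_add, Finset.sum_range_one, hv0, add_zero, mul_zero]
    constructor
    · ring
    · nlinarith [mul_nonneg hρ (sq_nonneg (x 0))]
  | succ n ih =>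
    intro hrec
    obtain ⟨h1, h2⟩ := ih fun i hi ↦ hrec i (Nat.lt_succ_of_lt hi)
    have hr : v (n + 1) = ρ * (v n + x n) := hrec n n.lt_succ_self
    rw [Finset.sum_range_succ _ (n + 1), Finset.sum_range_succ _ (n + 1),
      Finset.sum_range_succ (fun i ↦ (x i + v i) ^ 2) (n + 1)]
    constructor
    · linear_combination h1 - (v (n + 1) + ρ * (v n + x n)) * hr
    · have key : (1 - ρ) * (x (n + 1) + v (n + 1)) ^ 2 - ρ * (1 - ρ) * (x n + v n) ^ 2 ≤ x (n + 1) ^ 2 := by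
        rw [hr]
        nlinarith [mul_nonneg hρ (sq_nonneg (x (n + 1) + ρ * (v n + x n) - (v n + x n)))]
      nlinarith [h2, key]

/-- **KMS upper bound, causal form:** `Σ x_i² + 2Σ x_i v_i ≤ ((1+ρ)/(1−ρ))·Σ x_i²` for `0 ≤ ρ < 1`. -/
theorem kms_causal_upper {ρ : ℝ} (hρ : 0 ≤ ρ) (hρ1 : ρ < 1) (x v : ℕ → ℝ) (hv0 : v 0 = 0) (n : ℕ)
    (hrec : ∀ i < n, v (i + 1) = ρ * (v i + x i)) :
    ∑ i ∈ Finset.range (n + 1), x i ^ 2 + 2 * ∑ i ∈ Finset.range (n + 1), x i * v i ≤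
      (1 + ρ) / (1 - ρ) * ∑ i ∈ Finset.range (n + 1), x i ^ 2 := by
  obtain ⟨h1, h2⟩ := causal_filter_aux_upper hρ x v hv0 n hrec
  rw [h1]
  have h1ρ : 0 < 1 - ρ := by linarith
  have hc0 : 0 ≤ (1 + ρ) / (1 - ρ) := div_nonneg (by linarith) h1ρ.le
  have hc := mul_le_mul_of_nonneg_left h2 hc0
  have hid : (1 + ρ) / (1 - ρ) * ((1 - ρ) ^ 2 * ∑ i ∈ Finset.range (n + 1), (x i + v i) ^ 2 + ρ * (1 - ρ) * (x n + v n) ^ 2) =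
      (1 - ρ ^ 2) * ∑ i ∈ Finset.range (n + 1), (x i + v i) ^ 2 + ρ * (1 + ρ) * (x n + v n) ^ 2 := by
    field_simp
    ring
  have h3 : ρ ^ 2 * (x n + v n) ^ 2 ≤ ρ * (1 + ρ) * (x n + v n) ^ 2 :=
    mul_le_mul_of_nonneg_right (by nlinarith) (sq_nonneg _)
  linarith

/-- **KMS upper bound, anticausal form** (reflection of `kms_causal_upper`). -/
theorem kms_anticausal_upper {ρ : ℝ} (hρ : 0 ≤ ρ) (hρ1 : ρ < 1) (x t : ℕ → ℝ) (n : ℕ) (htn : t n = 0)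
    (hrec : ∀ i < n, t i = ρ * (t (i + 1) + x (i + 1))) :
    ∑ i ∈ Finset.range (n + 1), x i ^ 2 + 2 * ∑ i ∈ Finset.range (n + 1), x i * t i ≤
      (1 + ρ) / (1 - ρ) * ∑ i ∈ Finset.range (n + 1), x i ^ 2 := by
  have h := kms_causal_upper hρ hρ1 (fun i ↦ x (n - i)) (fun i ↦ t (n - i)) (by simp [htn]) n (by
    intro i hi
    have hj : n - (i + 1) + 1 = n - i := by omega
    have := hrec (n - (i + 1)) (by omega)
    rw [hj] at this
    simpa using this)
  have hx : ∑ i ∈ Finset.range (n + 1), x (n - i) ^ 2 = ∑ i ∈ Finset.range (n + 1), x i ^ 2 := by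
    simpa using Finset.sum_range_reflect (fun i ↦ x i ^ 2) (n + 1)
  have hxt : ∑ i ∈ Finset.range (n + 1), x (n - i) * t (n - i) = ∑ i ∈ Finset.range (n + 1), x i * t i := by
    simpa using Finset.sum_range_reflect (fun i ↦ x i * t i) (n + 1)
  simpa [hx, hxt] using h

/-- **Real fibre form, every `m`, upper side:** for `x : ℤ → ℝ` supported in `{0,…,m}` and `0 ≤ ρ < 1`,
`Σ_{e<m} ρ^{e+1}·Σ_i (x_i x_{i−e−1} + x_i x_{i+e+1}) ≤ (2ρ/(1−ρ))·Σ_i x_i²`, i.e. `K_{m+1}(ρ) − I ⪯ (2ρ/(1−ρ))·I`. -/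
theorem kms_offdiag_real_upper {ρ : ℝ} (hρ : 0 ≤ ρ) (hρ1 : ρ < 1) (m : ℕ) (x : ℤ → ℝ) (hx1 : ∀ n : ℤ, n < 0 → x n = 0)
    (hx2 : ∀ n : ℤ, (m : ℤ) < n → x n = 0) :
    0 ≤ 2 * ρ / (1 - ρ) * ∑ i ∈ Finset.range (m + 1), x i ^ 2 -
      ∑ e ∈ Finset.range m, ρ ^ (e + 1) *
        ∑ i ∈ Finset.range (m + 1), (x i * x ((i : ℤ) - (e + 1)) + x i * x ((i : ℤ) + (e + 1))) := by
  have h1ρ : (1 - ρ) ≠ 0 := by linarith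
  have hkey : 2 * ρ / (1 - ρ) = (1 + ρ) / (1 - ρ) - 1 := by field_simp; ring
  -- the causal and anticausal filters of `x`
  set v : ℕ → ℝ := fun i ↦ ∑ e ∈ Finset.range m, ρ ^ (e + 1) * x ((i : ℤ) - (e + 1)) with hvdef
  set t : ℕ → ℝ := fun i ↦ ∑ e ∈ Finset.range m, ρ ^ (e + 1) * x ((i : ℤ) + (e + 1)) with htdef
  have hsplit : ∑ e ∈ Finset.range m, ρ ^ (e + 1) *
        ∑ i ∈ Finset.range (m + 1), (x i * x ((i : ℤ) - (e + 1)) + x i * x ((i : ℤ) + (e + 1))) =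
      ∑ i ∈ Finset.range (m + 1), x i * v i + ∑ i ∈ Finset.range (m + 1), x i * t i := by
    have hA : ∑ e ∈ Finset.range m, ρ ^ (e + 1) * ∑ i ∈ Finset.range (m + 1), x i * x ((i : ℤ) - (e + 1)) =
        ∑ i ∈ Finset.range (m + 1), x i * v i := by
      simp only [hvdef, Finset.mul_sum]
      rw [Finset.sum_comm]
      exact Finset.sum_congr rfl fun i _ ↦ Finset.sum_congr rfl fun e _ ↦ by ring
    have hB : ∑ e ∈ Finset.range m, ρ ^ (e + 1) * ∑ i ∈ Finset.range (m + 1), x i * x ((i : ℤ) + (e + 1)) =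
        ∑ i ∈ Finset.range (m + 1), x i * t i := by
      simp only [htdef, Finset.mul_sum]
      rw [Finset.sum_comm]
      exact Finset.sum_congr rfl fun i _ ↦ Finset.sum_congr rfl fun e _ ↦ by ring
    rw [← hA, ← hB, ← Finset.sum_add_distrib]
    exact Finset.sum_congr rfl fun e _ ↦ by rw [Finset.sum_add_distrib, mul_add]
  rw [hsplit]
  rcases Nat.eq_zero_or_pos m with rfl | hm
  · simp only [hvdef, htdef, Finset.range_zero, Finset.sum_empty, mul_zero, Finset.sum_const_zero, add_zero, sub_zero]
    exact mul_nonneg (div_nonneg (by linarith) (by linarith)) (Finset.sum_nonneg fun _ _ ↦ sq_nonneg _)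
  obtain ⟨k, rfl⟩ := Nat.exists_eq_succ_of_ne_zero hm.ne'
  have hv0 : v 0 = 0 := by
    simp only [hvdef]
    exact Finset.sum_eq_zero fun e _ ↦ by rw [hx1 _ (by push_cast; omega), mul_zero]
  have hvrec : ∀ i < k + 1, v (i + 1) = ρ * (v i + x i) := by
    intro i hi
    have hz : x ((i : ℤ) - ((k : ℕ) + 1)) = 0 := hx1 _ (by omega)
    simp only [hvdef]
    rw [Finset.sum_range_succ', Finset.sum_range_succ, hz, mul_zero, add_zero, mul_add, Finset.mul_sum]
    congr 1
    · refine Finset.sum_congr rfl fun e _ ↦ ?_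
      have : (((i + 1 : ℕ) : ℤ) - (((e + 1 : ℕ) : ℤ) + 1)) = (i : ℤ) - ((e : ℤ) + 1) := by push_cast; ring
      rw [this]; ring
    · have : (((i + 1 : ℕ) : ℤ) - (((0 : ℕ) : ℤ) + 1)) = (i : ℤ) := by push_cast; ring
      rw [this]; ring
  have htm : t (k + 1) = 0 := by
    simp only [htdef]
    exact Finset.sum_eq_zero fun e _ ↦ by rw [hx2 _ (by push_cast; omega), mul_zero]
  have htrec : ∀ i < k + 1, t i = ρ * (t (i + 1) + x (i + 1)) := by
    intro i _
    have hz : x (((i + 1 : ℕ) : ℤ) + ((k : ℕ) + 1)) = 0 := hx2 _ (by push_cast; omega)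
    simp only [htdef]
    rw [Finset.sum_range_succ', Finset.sum_range_succ, hz, mul_zero, add_zero, mul_add, Finset.mul_sum]
    congr 1
    · refine Finset.sum_congr rfl fun e _ ↦ ?_
      have : ((i : ℤ) + (((e + 1 : ℕ) : ℤ) + 1)) = ((i + 1 : ℕ) : ℤ) + ((e : ℤ) + 1) := by push_cast; ring
      rw [this]; ring
    · have : ((i : ℤ) + (((0 : ℕ) : ℤ) + 1)) = (i : ℤ) + 1 := by push_cast; ring
      rw [this]; ring
  have hc := kms_causal_upper hρ hρ1 (fun i : ℕ ↦ x i) v hv0 (k + 1) hvrec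
  have ha := kms_anticausal_upper hρ hρ1 (fun i : ℕ ↦ x i) t (k + 1) htm htrec
  rw [hkey]
  nlinarith [hc, ha]

/-- **The uniform ceiling certificate:** for every prime `p`, every `m`, every `G : ℤ → ℂ` supported in `{0,…,m}`:
`(2·log p/(√p − 1))·Σ‖G_i‖² − Σ_{e<m} (log p/√(p^{e+1}))·Σ_i Re(G_i Ḡ_{i−e−1} + G_i Ḡ_{i+e+1}) ≥ 0`, i.e. `A_m(p) ⪯ (2·log p/(√p − 1))·I`. -/
theorem cert_uniform_upper {p : ℕ} (hp : p.Prime) (m : ℕ) (G : ℤ → ℂ) (hG1 : ∀ n : ℤ, n < 0 → G n = 0)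
    (hG2 : ∀ n : ℤ, (m : ℤ) < n → G n = 0) :
    0 ≤ 2 * Real.log p / (Real.sqrt p - 1) * ∑ i ∈ Finset.range (m + 1), ‖G i‖ ^ 2 -
      ∑ e ∈ Finset.range m, Real.log p / Real.sqrt ((p : ℝ) ^ (e + 1)) *
        ∑ i ∈ Finset.range (m + 1), (G i * conj (G ((i : ℤ) - (e + 1))) + G i * conj (G ((i : ℤ) + (e + 1)))).re := by
  have hp0 : (0 : ℝ) < p := by exact_mod_cast hp.pos
  have hp2 : (2 : ℝ) ≤ p := by exact_mod_cast hp.two_le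
  have hL : 0 ≤ Real.log p := Real.log_nonneg (by linarith)
  have hs1 : 1 < Real.sqrt p := by
    rw [show (1 : ℝ) = Real.sqrt 1 by simp]
    exact Real.sqrt_lt_sqrt (by norm_num) (by linarith)
  have hs0 : 0 < Real.sqrt p := by linarith
  set ρ : ℝ := (Real.sqrt p)⁻¹ with hρdef
  have hρ0 : 0 ≤ ρ := inv_nonneg.mpr hs0.le
  have hρ1 : ρ < 1 := inv_lt_one_of_one_lt₀ hs1
  have hw : ∀ e : ℕ, Real.log p / Real.sqrt ((p : ℝ) ^ (e + 1)) = Real.log p * ρ ^ (e + 1) := by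
    intro e
    have : Real.sqrt ((p : ℝ) ^ (e + 1)) = Real.sqrt p ^ (e + 1) := by
      rw [show ((p : ℝ) ^ (e + 1)) = (Real.sqrt p ^ (e + 1)) ^ 2 by
        rw [← pow_mul, mul_comm, pow_mul, Real.sq_sqrt hp0.le], Real.sqrt_sq (pow_nonneg hs0.le _)]
    rw [this, hρdef, inv_pow, div_eq_mul_inv]
  have hμ : 2 * Real.log p / (Real.sqrt p - 1) = Real.log p * (2 * ρ / (1 - ρ)) := by
    have : Real.sqrt p - 1 ≠ 0 := by linarith
    rw [hρdef]
    field_simp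
  have hre := kms_offdiag_real_upper hρ0 hρ1 m (fun n ↦ (G n).re) (fun n hn ↦ by simp [hG1 n hn]) (fun n hn ↦ by simp [hG2 n hn])
  have him := kms_offdiag_real_upper hρ0 hρ1 m (fun n ↦ (G n).im) (fun n hn ↦ by simp [hG1 n hn]) (fun n hn ↦ by simp [hG2 n hn])
  have hnorm : ∀ i : ℕ, ‖G i‖ ^ 2 = (G i).re ^ 2 + (G i).im ^ 2 := fun i ↦ by
    rw [Complex.sq_norm, Complex.normSq_apply]; ring
  have hprod : ∀ a b : ℤ, (G a * conj (G b)).re = (G a).re * (G b).re + (G a).im * (G b).im := fun a b ↦ by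
    simp only [Complex.mul_re, Complex.conj_re, Complex.conj_im]; ring
  have hsum := mul_nonneg hL (add_nonneg hre him)
  simp only [hw, hnorm, Complex.add_re, hprod, hμ]
  simp only [Finset.mul_sum, mul_add, mul_sub, Finset.sum_add_distrib] at hsum ⊢
  simp only [mul_assoc] at hsum ⊢
  simp only [← Finset.mul_sum] at hsum ⊢
  linarith

/-! ## §3  The all-window ceiling -/

/-- **All-window ceiling, `Q`-form:** for every prime `p ∈ S` and every Weil test function `g` supported in `[−c, c]` (any `c`):
`Re Q_{S∖{p}}(g) ≤ Re Q_S(g) + (2·log p/(√p − 1))·‖g‖₂²`. -/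
theorem re_weilSemilocalQuadratic_erase_le_uniform (hg : IsWeilTest g) {S : Finset ℕ} {p : ℕ} (hp : p.Prime) (hpS : p ∈ S)
    {c : ℝ} (hsupp : tsupport g ⊆ Icc (-c) c) :
    (weilSemilocalQuadratic (S.erase p) g).re ≤
      (weilSemilocalQuadratic S g).re + 2 * Real.log p / (Real.sqrt p - 1) * ∫ u : ℝ, ‖g u‖ ^ 2 := by
  have hL : 0 < Real.log p := Real.log_pos (by exact_mod_cast hp.one_lt)
  obtain ⟨m, hm⟩ := exists_nat_gt (2 * c / Real.log p)
  have hm' : 2 * c < (m + 1) * Real.log p := by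
    have := (div_lt_iff₀ hL).1 hm
    nlinarith
  exact re_weilSemilocalQuadratic_erase_le_of_cert hg hp hpS hsupp hm' fun G hG1 hG2 ↦ cert_uniform_upper hp m G hG1 hG2

/-- `2·log p/(√p − 1) ≥ 0` for a prime `p`. -/
theorem ceiling_const_nonneg {p : ℕ} (hp : p.Prime) : 0 ≤ 2 * Real.log p / (Real.sqrt p - 1) := by
  have hp2 : (2 : ℝ) ≤ p := by exact_mod_cast hp.two_le
  have hs1 : 1 < Real.sqrt p := by
    rw [show (1 : ℝ) = Real.sqrt 1 by simp]
    exact Real.sqrt_lt_sqrt (by norm_num) (by linarith)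
  exact div_nonneg (mul_nonneg (by norm_num) (Real.log_nonneg (by linarith))) (by linarith)

/-- **All-window ceiling for the bottoms:** for every prime `p ∈ S`, every `c`, every `P`:
`λ_min(S∖{p}; c; P) ≤ λ_min(S; c; P) + 2·log p/(√p − 1)` — adding a prime lowers no bottom by more than `2·log p/(√p − 1)`. -/
theorem semilocalGroundEnergy_erase_le_uniform {S : Finset ℕ} {p : ℕ} (hp : p.Prime) (hpS : p ∈ S) (c : ℝ) :
    semilocalGroundEnergy (S.erase p) P c - 2 * Real.log p / (Real.sqrt p - 1) ≤ semilocalGroundEnergy S P c := by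
  have hL : 0 < Real.log p := Real.log_pos (by exact_mod_cast hp.one_lt)
  obtain ⟨m, hm⟩ := exists_nat_gt (2 * c / Real.log p)
  have hm' : 2 * c < (m + 1) * Real.log p := by
    have := (div_lt_iff₀ hL).1 hm
    nlinarith
  exact semilocalGroundEnergy_erase_le_of_cert hp hpS hm' (ceiling_const_nonneg hp) fun G hG1 hG2 ↦ cert_uniform_upper hp m G hG1 hG2

/-- **Deleting a set of primes, ceiling side:** `λ_min(S∖T; c; P) ≤ λ_min(S; c; P) + Σ_{p∈T} 2·log p/(√p − 1)`. -/
theorem semilocalGroundEnergy_sdiff_le_uniform {S T : Finset ℕ} (hT : ∀ p ∈ T, p.Prime) (c : ℝ) :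
    semilocalGroundEnergy (S \ T) P c - ∑ p ∈ T, 2 * Real.log p / (Real.sqrt p - 1) ≤ semilocalGroundEnergy S P c := by
  induction T using Finset.induction_on with
  | empty => simp
  | @insert a T haT ih =>
    have ih' := ih fun p hp ↦ hT p (Finset.mem_insert_of_mem hp)
    have ha : a.Prime := hT a (Finset.mem_insert_self a T)
    rw [Finset.sum_insert haT, Finset.sdiff_insert]
    have hcost := ceiling_const_nonneg ha
    by_cases haS : a ∈ S \ T
    · have := semilocalGroundEnergy_erase_le_uniform (P := P) ha haS c
      linarith
    · rw [Finset.erase_eq_of_notMem haS]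
      linarith

end Summit.RiemannHypothesis.RiemannHypothesis.Theorems.SemilocalDeletionToeplitzCeiling
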